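import Summits.HubbardSuperconductivity.HubbardLadder.Bounds.StiffnessFromEnergyBracketsTPrime
import Literature.MathematicalPhysics.QuantumLattice.HubbardAtomicLimit
import Literature.MathematicalPhysics.QuantumLattice.HubbardLangerMattisFourByFour
import HarnessLib

/-!
# EDCornerBound — the many-body corner constant of the E-D-2″ certificate (T7.1, pub-hubbard r3)

HONEST FRAMING (page 1): ladder R1–R4 with certified numbers; no claim on H/H₀. This file proves the ONE
many-body input of the ED inertia certificate "E-D-2″" (`pub-hubbard-r3/EFFICIENCY-ED2p.md` §A, T7.1;
`R4-MEMO.md` §7): a lower bound on the quadratic form of the Hubbard torus Hamiltonian on vectors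
supported on configurations with at least `d₀` doubly occupied sites,
`Re⟨ψ, H ψ⟩ ≥ (−4 S_L(t') + U d₀) ‖ψ‖²`, `S_L(t') = Σ_k (cos k₁ + cos k₂ + 2t' cos k₁ cos k₂)⁺`
(Lieb–Loss bathtub for the one-body symbol, via the tree's `kinWeightTT'_sum_le` at `ν = 0`, plus
diagonality of the interaction). It is the hypothesis `(A − c•G).PosSemidef`, `c = −4S + U d₀ − ρ`, on the
FREE (high-double-occupancy) block of the pencil in
`Literature.Analysis.OperatorTheory.fromBlocks_dotProduct_nonneg_of_pencil_schur_poly_cert` after frame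
compression (a form inequality valid for every `ψ` in the span of the high orbit sums holds for the
compressed pencil). At `L = 4`: `S_4(0) = 6` (`⟨T⟩ ≥ −24`) and `S_4(−1/4) = 13/2` (`⟨T⟩ ≥ −26`), the
exact free-fermion values of `census/schur_sizing.json`; with `U = 8`, `d₀ = 2`, `ρ = −11.8` (`t' = 0`)
the corner constant is `c = −24 + 16 + 11.8 = 3.8`.
Both the `t' = 0` bound (`re_expect_hubbardTorus_ge_corner`, via `re_expect_hubbardTorus_eq_kin`) and the
`t–t'` bound (`re_expect_hubbardTorusTT'_ge_corner`, via bounds part 2 `re_expect_hubbardTorusTT'_eq_kin`)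
are unconditional; the `4 × 4`, `U = 8`, `d₀ = 2` rows are `⟨ψ, Hψ⟩ ≥ −8‖ψ‖²` (`t' = 0`) and
`≥ −10‖ψ‖²` (`t' = −1/4`). No certificate exists; nothing here is numerical evidence for R3.
-/

noncomputable section

namespace Summit.HubbardSuperconductivity.HubbardLadder.Bounds

open Matrix Finset Real
open Literature.MathematicalPhysics.QuantumLattice
open Literature.Probability.LatticeModels
open scoped ComplexOrder ComplexConjugate

variable {L : ℕ} [NeZero L]

/-- The corner bathtub sum `S_L(t') = Σ_k (cos k₁ + cos k₂ + 2t' cos k₁ cos k₂)⁺ = Σ_k ttBathtub (t'/2) 0 k`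
(`−4 S_L(t')` bounds the hopping energy `−2(K_x + K_y + t'K_diag)` of EVERY Fock vector from below). -/
def cornerBathtubSum (L : ℕ) [NeZero L] (t' : ℝ) : ℝ := ∑ k : TorusSite 2 L, ttBathtub (t' / 2) 0 k

/-- **Hopping bound, every state**: `K_x + K_y + t' K_diag ≤ 2 S_L(t') ‖ψ‖²` (`L ≥ 2`; the tree's
`kinWeightTT'_sum_le` at `ν = 0` with `t' ↦ t'/2`; no particle-number input). -/
theorem kinWeight_le_cornerBathtubSum (hL : 2 ≤ L) (t' : ℝ) (ψ : Fock (Orb (FermionTorus 2 L))) :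
    kinWeightDir 0 ψ + kinWeightDir 1 ψ + t' * kinWeightDiag ψ ≤
      2 * cornerBathtubSum L t' * (star ψ ⬝ᵥ ψ).re := by
  have h := kinWeightTT'_sum_le hL (t' / 2) 0 ψ
  have h2 : 2 * (t' / 2) = t' := by ring
  rw [h2, zero_mul, zero_add] at h
  exact h

omit [NeZero L] in
/-- **Diagonal bound**: if `ψ` vanishes on every configuration with fewer than `d₀` doubly occupied
sites, then `D(ψ) ≥ d₀ ‖ψ‖²` (the interaction is diagonal with eigenvalue `#doubly-occupied`). -/
theorem doubleOccExp_ge_of_support (d₀ : ℕ) (ψ : Fock (Orb (FermionTorus 2 L)))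
    (hψ : ∀ s, (doublyOccupied s).card < d₀ → ψ s = 0) :
    (d₀ : ℝ) * (star ψ ⬝ᵥ ψ).re ≤ doubleOccExp ψ := by
  classical
  unfold doubleOccExp
  rw [sum_numberOp_mul_numberOp_eq_diagonal]
  simp only [dotProduct, mulVec_diagonal, Pi.star_apply, Complex.re_sum, Finset.mul_sum]
  refine Finset.sum_le_sum fun s _ => ?_
  have hss : star (ψ s) * ψ s = ((‖ψ s‖ ^ 2 : ℝ) : ℂ) := by
    rw [Complex.star_def, ← Complex.normSq_eq_conj_mul_self, Complex.normSq_eq_norm_sq]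
  rw [mul_left_comm, hss, ← Complex.ofReal_natCast, ← Complex.ofReal_mul, Complex.ofReal_re,
    Complex.ofReal_re]
  by_cases hlt : (doublyOccupied s).card < d₀
  · rw [hψ s hlt, norm_zero]
    simp
  · exact mul_le_mul_of_nonneg_right (by exact_mod_cast Nat.le_of_not_lt hlt) (sq_nonneg _)

/-- **Corner bound at `t' = 0` (unconditional)**: for `L ≥ 3`, `0 ≤ U`, and `ψ` supported on
configurations with `≥ d₀` doubly occupied sites,
`(−4 S_L(0) + U d₀) ‖ψ‖² ≤ Re⟨ψ, H_L(1, U) ψ⟩`. -/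
theorem re_expect_hubbardTorus_ge_corner (hL : 3 ≤ L) {U : ℝ} (hU : 0 ≤ U) (d₀ : ℕ)
    (ψ : Fock (Orb (FermionTorus 2 L))) (hψ : ∀ s, (doublyOccupied s).card < d₀ → ψ s = 0) :
    (-(4 * cornerBathtubSum L 0) + U * d₀) * (star ψ ⬝ᵥ ψ).re ≤
      (star ψ ⬝ᵥ (hubbardTorus 2 L 1 U *ᵥ ψ)).re := by
  have hK := kinWeight_le_cornerBathtubSum (le_trans (by norm_num) hL) 0 ψ
  rw [zero_mul, add_zero] at hK
  have hD := doubleOccExp_ge_of_support d₀ ψ hψ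
  rw [re_expect_hubbardTorus_eq_kin hL U ψ]
  nlinarith [mul_le_mul_of_nonneg_left hD hU]

/-- **Corner bound for the `t–t'` class**: for `L ≥ 3`, `0 ≤ U`, every `t'`, and `ψ` supported on
configurations with `≥ d₀` doubly occupied sites,
`(−4 S_L(t') + U d₀) ‖ψ‖² ≤ Re⟨ψ, H^{tt'}_L(1, t', U) ψ⟩` (energy identity of bounds part 2). -/
theorem re_expect_hubbardTorusTT'_ge_corner (hL : 3 ≤ L) {U : ℝ} (hU : 0 ≤ U) (t' : ℝ) (d₀ : ℕ)
    (ψ : Fock (Orb (FermionTorus 2 L))) (hψ : ∀ s, (doublyOccupied s).card < d₀ → ψ s = 0) :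
    (-(4 * cornerBathtubSum L t') + U * d₀) * (star ψ ⬝ᵥ ψ).re ≤
      (star ψ ⬝ᵥ (hubbardTorusTT' L 1 t' U *ᵥ ψ)).re := by
  have hK := kinWeight_le_cornerBathtubSum (le_trans (by norm_num) hL) t' ψ
  have hD := doubleOccExp_ge_of_support d₀ ψ hψ
  rw [re_expect_hubbardTorusTT'_eq_kin hL t' U ψ]
  nlinarith [mul_le_mul_of_nonneg_left hD hU]

/-! ### The `4 × 4` values `S_4(0) = 6`, `S_4(−1/4) = 13/2` -/

/-- The `4 × 4` corner sum written over the cosines `1, 0, −1, 0`. -/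
theorem cornerBathtubSum_four_eq (t' : ℝ) :
    cornerBathtubSum 4 t' = ∑ ab : Fin 4 × Fin 4,
      max (LangerMattis.cosFour ab.1.val + LangerMattis.cosFour ab.2.val +
        4 * (t' / 2) * (LangerMattis.cosFour ab.1.val * LangerMattis.cosFour ab.2.val) - 0) 0 := by
  unfold cornerBathtubSum ttBathtub
  refine Fintype.sum_equiv (piFinTwoEquiv fun _ => ZMod 4) _ _ fun k => ?_
  rw [LangerMattis.cos_latticeMomentum_four, LangerMattis.cos_latticeMomentum_four]
  rfl

/-- The values `cos(2πj/4)`, `j = 0,…,3`, of the lattice-momentum table `LangerMattis.cosFour`. -/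
private theorem cosFour_vals : LangerMattis.cosFour 0 = 1 ∧ LangerMattis.cosFour 1 = 0 ∧
    LangerMattis.cosFour 2 = -1 ∧ LangerMattis.cosFour 3 = 0 := ⟨rfl, rfl, rfl, rfl⟩

/-- The numerals `0,…,3 : Fin 4` have the expected values (for `simp` on `Fin.sum_univ_four`). -/
private theorem fin4_vals : (0 : Fin 4).val = 0 ∧ (1 : Fin 4).val = 1 ∧ (2 : Fin 4).val = 2 ∧
    (3 : Fin 4).val = 3 := ⟨rfl, rfl, rfl, rfl⟩

/-- `S_4(0) = 6`: the hopping energy of every state of the `4 × 4` nearest-neighbour torus is `≥ −24`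
(the exact `(7,7)` free-fermion ground energy). -/
theorem cornerBathtubSum_four_zero : cornerBathtubSum 4 0 = 6 := by
  rw [cornerBathtubSum_four_eq, Fintype.sum_prod_type]
  simp only [Fin.sum_univ_four, fin4_vals.1, fin4_vals.2.1, fin4_vals.2.2.1, fin4_vals.2.2.2,
    cosFour_vals.1, cosFour_vals.2.1, cosFour_vals.2.2.1, cosFour_vals.2.2.2]
  norm_num

/-- `S_4(−1/4) = 13/2`: the hopping energy of every state of the `4 × 4` `t–t'` torus at `t' = −1/4` is
`≥ −26` (the exact `(7,7)` free-fermion ground energy at `t' = −1/4`). -/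
theorem cornerBathtubSum_four_negQuarter : cornerBathtubSum 4 (-1 / 4) = 13 / 2 := by
  rw [cornerBathtubSum_four_eq, Fintype.sum_prod_type]
  simp only [Fin.sum_univ_four, fin4_vals.1, fin4_vals.2.1, fin4_vals.2.2.1, fin4_vals.2.2.2,
    cosFour_vals.1, cosFour_vals.2.1, cosFour_vals.2.2.1, cosFour_vals.2.2.2]
  norm_num

/-- **The `t' = 0` corner constant at `L = 4`, `U = 8`, `d₀ = 2`**: every `ψ` supported on configurations
with at least two doubly occupied sites has `Re⟨ψ, H_4(1, 8) ψ⟩ ≥ −8 ‖ψ‖²` (`= −24 + 16`); with the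
certified sector upper bound `ρ = −11.8` this is the corner constant `c = 3.8` of EFFICIENCY-ED2p §5. -/
theorem re_expect_hubbardTorus_four_U8_ge_corner (ψ : Fock (Orb (FermionTorus 2 4)))
    (hψ : ∀ s, (doublyOccupied s).card < 2 → ψ s = 0) :
    (-8 : ℝ) * (star ψ ⬝ᵥ ψ).re ≤ (star ψ ⬝ᵥ (hubbardTorus 2 4 1 8 *ᵥ ψ)).re := by
  have h := re_expect_hubbardTorus_ge_corner (L := 4) (by norm_num) (by norm_num : (0 : ℝ) ≤ 8) 2 ψ hψ
  rw [cornerBathtubSum_four_zero] at h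
  norm_num at h
  linarith

/-- **The `t' = −1/4` corner constant at `L = 4`, `U = 8`, `d₀ = 2`**: every `ψ` supported on
configurations with at least two doubly occupied sites has `Re⟨ψ, H^{tt'}_4(1, −1/4, 8) ψ⟩ ≥ −10 ‖ψ‖²`
(`= −26 + 16`). -/
theorem re_expect_hubbardTorusTT'_four_U8_ge_corner (ψ : Fock (Orb (FermionTorus 2 4)))
    (hψ : ∀ s, (doublyOccupied s).card < 2 → ψ s = 0) :
    (-10 : ℝ) * (star ψ ⬝ᵥ ψ).re ≤ (star ψ ⬝ᵥ (hubbardTorusTT' 4 1 (-1 / 4) 8 *ᵥ ψ)).re := by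
  have h := re_expect_hubbardTorusTT'_ge_corner (L := 4) (by norm_num) (by norm_num : (0 : ℝ) ≤ 8)
    (-1 / 4) 2 ψ hψ
  rw [cornerBathtubSum_four_negQuarter] at h
  norm_num at h
  linarith

/-! ### Typed obligations (the cell's house style: `@[conjecture] def` + `_holds`) -/

/-- **Typed obligation T7.1 — the E-D-2″ corner constant for the `t–t'` class.** For `L ≥ 3`, every
`t'`, `U ≥ 0`, `d₀`, and every Fock vector `ψ` vanishing on configurations with fewer than `d₀` doubly
occupied sites, `(−4 S_L(t') + U d₀) ‖ψ‖² ≤ Re⟨ψ, H^{tt'}_L(1, t', U) ψ⟩`. PROVED (`edCornerBoundTT'_holds`);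
it is the free-block hypothesis of the Schur/pencil inertia certificate after frame compression
(`Literature…TempleKato.frame_form_ge_of_support_bound`). -/
@[conjecture] def EDCornerBoundTT' : Prop :=
  ∀ (L : ℕ) [NeZero L], 3 ≤ L → ∀ (t' U : ℝ), 0 ≤ U → ∀ (d₀ : ℕ) (ψ : Fock (Orb (FermionTorus 2 L))),
    (∀ s, (doublyOccupied s).card < d₀ → ψ s = 0) →
      (-(4 * cornerBathtubSum L t') + U * d₀) * (star ψ ⬝ᵥ ψ).re ≤
        (star ψ ⬝ᵥ (hubbardTorusTT' L 1 t' U *ᵥ ψ)).re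

/-- **Proof of `EDCornerBoundTT'`.** -/
theorem edCornerBoundTT'_holds : EDCornerBoundTT' :=
  fun _ _ hL t' _ hU d₀ ψ hψ => re_expect_hubbardTorusTT'_ge_corner hL hU t' d₀ ψ hψ

/-- **Typed obligation T7.1 rows at `L = 4`, `U = 8`, `d₀ = 2`**: the corner constants of the two
`(7,7)`-sector certificates of the R3 design, `⟨ψ, H_4(1,8) ψ⟩ ≥ −8‖ψ‖²` (`t' = 0`, pure model) and
`⟨ψ, H^{tt'}_4(1,−1/4,8) ψ⟩ ≥ −10‖ψ‖²` (`t' = −1/4`), for every `ψ` supported on configurations with at least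
two doubly occupied sites. PROVED (`edCornerBoundRowsFour_holds`). Format/calibration rows; no certificate
of the R3 window exists. -/
@[conjecture] def EDCornerBoundRowsFour : Prop :=
  (∀ ψ : Fock (Orb (FermionTorus 2 4)), (∀ s, (doublyOccupied s).card < 2 → ψ s = 0) →
      (-8 : ℝ) * (star ψ ⬝ᵥ ψ).re ≤ (star ψ ⬝ᵥ (hubbardTorus 2 4 1 8 *ᵥ ψ)).re) ∧
    (∀ ψ : Fock (Orb (FermionTorus 2 4)), (∀ s, (doublyOccupied s).card < 2 → ψ s = 0) →
      (-10 : ℝ) * (star ψ ⬝ᵥ ψ).re ≤ (star ψ ⬝ᵥ (hubbardTorusTT' 4 1 (-1 / 4) 8 *ᵥ ψ)).re)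

/-- **Proof of `EDCornerBoundRowsFour`.** -/
theorem edCornerBoundRowsFour_holds : EDCornerBoundRowsFour :=
  ⟨re_expect_hubbardTorus_four_U8_ge_corner, re_expect_hubbardTorusTT'_four_U8_ge_corner⟩

end Summit.HubbardSuperconductivity.HubbardLadder.Bounds


end
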